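import Literature.NumberTheory.EllipticCurves.AnticyclotomicInertiaAboveP
import Literature.NumberTheory.EllipticCurves.ZpExtensionPadicUnitsProofs
import Literature.NumberTheory.EllipticCurves.GreenbergSelmer
import HarnessLib

/-!
# The `ℤ_p²`-tower of an imaginary quadratic field is unramified over its anticyclotomic line
# above a split prime `p` — ALL primes `p`, including `p = 2`

Topic `NumberTheory/EllipticCurves` (Iwasawa theory of `ℤ_p`-extensions); namespace
`Literature.NumberTheory.EllipticCurves.ZpExtension`.  THEOREMS ONLY (no definition, no named fact,
no instance; D-0026).  Sequel of `AnticyclotomicInertiaAboveP.lean`, which proves, for `K` imaginary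
quadratic, `p` an ODD prime split in `K`, `κ₁` anticyclotomic and `κ₂` any `ℤ_p`-extension of `K`,
that `I_𝔓 ⊓ ker κ₁ ≤ ker κ₂` for every prime `𝔓` of `\bar ℤ_K` above `p` ("`K̃_∞/K_∞⁻` is unramified
above `p`": Greenberg, LNM 1716 §1 p. 53; Greenberg 1978 §4 p. 94; de Shalit II.4.17; Brink 2007
Cor. 1).  The hypothesis `p ≠ 2` entered there at exactly two places, both inessential:

* §1 there ("two `ℤ_p`-valued characters of `Γ_{ℚ_p}` are proportional on inertia") used the
  cyclicity of `(ℤ/p^m)ˣ`.  Here (`toAdd_mul_toAdd_comm_of_mem_absInertia`) the same conclusion is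
  derived for EVERY `p` from the local Kronecker–Weber theorem in inertia form (Serre, *Local Fields*
  XIV §7 Thm. 2; tree `adicCompletion_rat_exists_eq_comp_cyclotomicCharacter_of_mem_absInertia`) as
  printed: a continuous `ℤ_p`-valued character of `Γ_{ℚ_p}` kills `I_{ℚ_p} ∩ ker χ_p`
  (`apply_eq_one_of_mem_absInertia_of_cyclotomicCharacter_eq_one`), hence is `g ∘ χ_p` on `I_{ℚ_p}`
  for a continuous character `g` of `ℤ_pˣ = χ_p(I_{ℚ_p})` (Serre IV §4 Prop. 17; tree
  `adicCompletion_rat_exists_mem_absInertia_cyclotomicCharacter_eq`;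
  `exists_continuousMonoidHom_apply_cyclotomicCharacter_eq_of_mem_absInertia`), and
  `Hom_cont(ℤ_pˣ, ℤ_p)` has rank `≤ 1` uniformly in `p` (Serre, *Cours d'arithmétique* II §3; tree
  `PadicUnits.dependent`, generator `1 + p³`).  A torsion value of `χ_p` on inertia is killed:
  `apply_eq_one_of_mem_absInertia_of_cyclotomicCharacter_pow_eq_one`.
* §3 there (Brink: `K_∞⁻/K` is ramified at every prime above `p`, class number finite) used
  "`[K_n : K] = pⁿ` odd ⟹ unramified at infinity".  An imaginary quadratic field is totally complex, so
  EVERY extension of it is unramified at the infinite places (Mathlib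
  `InfinitePlace.isUnramified_iff`): `inertia_not_le_kerSubgroup_of_isAnticyclotomic_anyPrime`.

§2 (transport `Γ_{ℚ_p} → Γ_K` at a completely split `p`, Neukirch I (9.1), (9.3), II (9.6)) is the
parent file's, isolated as `exists_continuous_hom_transport_inertia_of_ncard_primesOver_eq` with two
more outputs recorded (the transport maps `I_{ℚ_p}` INTO `I_𝔓` and preserves the `p`-adic cyclotomic
character); §4 assembles `inertia_inf_kerSubgroup_le_kerSubgroup_of_isAnticyclotomic_anyPrime`.
Two corollaries for the consumers: `exists_mem_inertia_cyclotomicCharacter_eq_of_pow_eq_one_of_ne`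
(at a split prime of a quadratic field every torsion unit `u ∈ ℤ_pˣ` is `χ_p(τ)` for some `τ ∈ I_𝔓`
acting trivially on EVERY `ℤ_p`-extension — e.g. `u = -1`, `p = 2`: an inertial `τ` with
`χ₂(τ) = -1` fixing `K̃_∞`), and the same statements in the currency of the tree's Greenberg Selmer
groups (`GreenbergSelmer.inertia w = I_{𝔓₀}`, `𝔓₀ = adicCompletionPrime K w`, tree
`inertia_adicCompletionPrime_eq_map_absInertia`), §5.  Consumed by the BSD cell `bsd-2adic` at `p = 2`
(crux `BDPSelmerLowerDivisibilityAtTwo`: the door `X_Gr₂ → 𝔛_ac`, hypotheses `hgen`/`hord`).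
Nothing here concerns an elliptic curve; BSD is not advanced by this file beyond supplying a
class-field-theoretic input by a kernel theorem instead of a displayed hypothesis.

## References

* J.-P. Serre, *Local Fields*, GTM 67 (1979), Ch. XIV §7 Thm. 2 (local Kronecker–Weber), Ch. IV
  §4 Prop. 17. [SerreLocalFields1979]
* L. C. Washington, *Introduction to Cyclotomic Fields*, 2nd ed., §13.1 Prop. 13.2, Thm. 13.4,
  Thm. 14.2. [Washington1997]
* R. Greenberg, *Iwasawa theory for elliptic curves*, LNM 1716 (1999), §1 p. 53. [GreenbergLNM1716]
* R. Greenberg, Invent. Math. 47 (1978), §4 p. 94. [Greenberg1978]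
* E. de Shalit, *Iwasawa theory of elliptic curves with complex multiplication* (1987), II.1.9,
  II.4.17. [deShalit1987]
* D. Brink, Math. Comp. 76 (2007), Cor. 1 (p. 2136) and §II Prop. 1. [Brink2007]
* J. Neukirch, *Algebraic Number Theory* (1999), Ch. I §9 (9.1), (9.3); Ch. II §9 (9.6).
  [NeukirchANT1999]
-/

noncomputable section

open scoped NumberField Pointwise
open Field NumberField IsDedekindDomain ValuativeRel

namespace Literature.NumberTheory.EllipticCurves.ZpExtension

open Literature.NumberTheory.GaloisRepresentations Literature.NumberTheory.NumberFields

/-! ### §1. `ℤ_p`-valued characters of `Γ_{ℚ_p}` on inertia, any `p` -/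

section Local

variable (p : ℕ) [Fact p.Prime] (u : HeightOneSpectrum (𝓞 ℚ))

/-- **A continuous `ℤ_p`-valued character of `Γ_{ℚ_p}` kills `I_{ℚ_p} ∩ ker χ_p`** (`ℚ_u` the
completion of `ℚ` at the place `u` above `p`).  Level by level: modulo `pⁿ` the character has open
kernel and commutative image, so by the inertia form of the local Kronecker–Weber theorem (Serre,
*Local Fields* XIV §7 Thm. 2; tree `adicCompletion_rat_exists_eq_comp_cyclotomicCharacter_of_mem_absInertia`)
it is `g(χ_p mod p^m)` on `I_{ℚ_u}`, which is `g(1) = 0` at `σ` with `χ_p(σ) = 1`.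
[cite: SerreLocalFields1979, Ch. XIV §7 Thm. 2] [cite: Washington1997, Thm. 14.2] -/
theorem apply_eq_one_of_mem_absInertia_of_cyclotomicCharacter_eq_one
    (hu : (Rat.HeightOneSpectrum.primesEquiv u : ℕ) = p)
    (Λ : absoluteGaloisGroup (u.adicCompletion ℚ) →* Multiplicative ℤ_[p]) (hΛ : Continuous Λ)
    {σ : absoluteGaloisGroup (u.adicCompletion ℚ)} (hσ : σ ∈ absInertia (u.adicCompletion ℚ))
    (hχ : GaloisRep.cyclotomicCharacter (u.adicCompletion ℚ) p σ = 1) : Λ σ = 1 := by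
  apply Multiplicative.toAdd.injective
  rw [toAdd_one]
  refine PadicInt.ext_of_toZModPow.mp fun n => ?_
  rw [map_zero]
  -- the level-`n` reduction
  set r : Multiplicative ℤ_[p] →* Multiplicative (ZMod (p ^ n)) :=
    (PadicInt.toZModPow n).toAddMonoidHom.toMultiplicative with hr_def
  set Λn : absoluteGaloisGroup (u.adicCompletion ℚ) →* Multiplicative (ZMod (p ^ n)) :=
    r.comp Λ with hΛn_def
  have hΛn : ∀ x, (Λn x).toAdd = PadicInt.toZModPow n (Λ x).toAdd := fun x => rfl
  have hU : IsOpen {z : ℤ_[p] | PadicInt.toZModPow n z = 0} :=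
    OneUnits.isOpen_setOf_toZModPow_eq p n 0
  have hker : (Λn.ker : Set (absoluteGaloisGroup (u.adicCompletion ℚ))) =
      (fun x => (Λ x).toAdd) ⁻¹' {z : ℤ_[p] | PadicInt.toZModPow n z = 0} := by
    ext x
    simp only [SetLike.mem_coe, MonoidHom.mem_ker, Set.mem_preimage, Set.mem_setOf_eq, ← hΛn]
    constructor
    · intro h; rw [h]; rfl
    · intro h; exact Multiplicative.toAdd.injective (by rw [h]; rfl)
  have hopen : IsOpen (Λn.ker : Set (absoluteGaloisGroup (u.adicCompletion ℚ))) := by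
    rw [hker]
    exact hU.preimage (continuous_toAdd.comp hΛ)
  have hcomm : ∀ a b, Λn a * Λn b = Λn b * Λn a := fun a b => mul_comm _ _
  obtain ⟨m, -, g, hg⟩ :=
    adicCompletion_rat_exists_eq_comp_cyclotomicCharacter_of_mem_absInertia p u hu Λn hopen hcomm
  have h := hg σ hσ
  rw [hχ, map_one, map_one] at h
  rw [← hΛn, h]
  rfl

/-- **A continuous `ℤ_p`-valued character of `Γ_{ℚ_p}` factors through `χ_p` on inertia**: there is a
continuous character `g : ℤ_pˣ → ℤ_p` with `Λ(σ) = g(χ_p(σ))` for all `σ ∈ I_{ℚ_u}`.  Indeed `Λ|_I`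
kills `I ∩ ker χ_p` (`apply_eq_one_of_mem_absInertia_of_cyclotomicCharacter_eq_one`), `χ_p|_I` is onto
`ℤ_pˣ` (Serre IV §4 Prop. 17, `ℚ_p(μ_{p^∞})/ℚ_p` totally ramified; tree
`adicCompletion_rat_exists_mem_absInertia_cyclotomicCharacter_eq`) and a continuous surjection from
the compact group `I_{ℚ_u}` onto the Hausdorff group `ℤ_pˣ` is a quotient map.
[cite: SerreLocalFields1979, Ch. XIV §7 Thm. 2] [cite: SerreLocalFields1979, Ch. IV §4 Prop. 17] -/
theorem exists_continuousMonoidHom_apply_cyclotomicCharacter_eq_of_mem_absInertia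
    (hu : (Rat.HeightOneSpectrum.primesEquiv u : ℕ) = p)
    (Λ : absoluteGaloisGroup (u.adicCompletion ℚ) →* Multiplicative ℤ_[p]) (hΛ : Continuous Λ) :
    ∃ g : ℤ_[p]ˣ →ₜ* Multiplicative ℤ_[p], ∀ σ ∈ absInertia (u.adicCompletion ℚ),
      g (GaloisRep.cyclotomicCharacter (u.adicCompletion ℚ) p σ) = Λ σ := by
  set I : Subgroup (absoluteGaloisGroup (u.adicCompletion ℚ)) := absInertia (u.adicCompletion ℚ)
    with hI_def
  set χ := GaloisRep.cyclotomicCharacter (u.adicCompletion ℚ) p with hχ_def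
  set χI : I →* ℤ_[p]ˣ := χ.toMonoidHom.comp I.subtype with hχI_def
  set ΛI : I →* Multiplicative ℤ_[p] := Λ.comp I.subtype with hΛI_def
  have hχI : ∀ σ : I, χI σ = χ σ := fun σ => rfl
  have hΛI : ∀ σ : I, ΛI σ = Λ σ := fun σ => rfl
  have hsurj : Function.Surjective χI := by
    intro v
    obtain ⟨σ, hσ, h⟩ := adicCompletion_rat_exists_mem_absInertia_cyclotomicCharacter_eq p u hu v
    exact ⟨⟨σ, hσ⟩, h⟩
  have hker : χI.ker ≤ ΛI.ker := by
    intro σ hσ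
    rw [MonoidHom.mem_ker] at hσ ⊢
    rw [hΛI]
    exact apply_eq_one_of_mem_absInertia_of_cyclotomicCharacter_eq_one p u hu Λ hΛ σ.2 hσ
  have hs : Function.RightInverse (Function.surjInv hsurj) χI := Function.rightInverse_surjInv hsurj
  let g₀ : ℤ_[p]ˣ →* Multiplicative ℤ_[p] :=
    MonoidHom.liftOfRightInverse χI (Function.surjInv hsurj) hs ⟨ΛI, hker⟩
  have hg₀ : ∀ σ : I, g₀ (χI σ) = ΛI σ := fun σ =>
    MonoidHom.liftOfRightInverse_comp_apply χI (Function.surjInv hsurj) hs ⟨ΛI, hker⟩ σ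
  -- continuity
  haveI : CompactSpace (absoluteGaloisGroup (u.adicCompletion ℚ)) :=
    absoluteGaloisGroup_compactSpace (u.adicCompletion ℚ)
  haveI : CompactSpace I :=
    isCompact_iff_compactSpace.mp (isClosed_absInertia_holds (u.adicCompletion ℚ)).isCompact
  have hχIc : Continuous χI := χ.continuous.comp continuous_subtype_val
  have hq : Topology.IsQuotientMap χI := (hχIc.isClosedMap).isQuotientMap hχIc hsurj
  have hcont : Continuous g₀ := by
    rw [hq.continuous_iff]
    have hcomp : (g₀ : ℤ_[p]ˣ → Multiplicative ℤ_[p]) ∘ χI = ΛI := funext hg₀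
    rw [hcomp]
    exact hΛ.comp continuous_subtype_val
  refine ⟨{ g₀ with continuous_toFun := hcont }, fun σ hσ => ?_⟩
  exact hg₀ ⟨σ, hσ⟩

/-- **Two continuous `ℤ_p`-valued characters of `Γ_{ℚ_p}` are proportional on the inertia group**,
for EVERY prime `p` (additively: `Λ₁(σ)·Λ₂(τ) = Λ₂(σ)·Λ₁(τ)` in `ℤ_p` for `σ, τ ∈ I_{ℚ_u}`; the tree's
`padicCharacters_toAdd_mul_comm_of_mem_absInertia` assumed `p` odd).  Both factor on inertia through
`χ_p` (`exists_continuousMonoidHom_apply_cyclotomicCharacter_eq_of_mem_absInertia`), and any two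
continuous characters `ℤ_pˣ → ℤ_p` are `ℤ_p`-linearly dependent (tree `PadicUnits.dependent`:
`Hom_cont(ℤ_pˣ, ℤ_p)` has rank one, topological generator `1 + p³` — uniform in `p`); a non-trivial
linear relation makes all `2 × 2` minors vanish (`ℤ_p` is a domain).  Equivalently: the inertia
subgroup of `Gal(ℚ_p^{ab}/ℚ_p)` is `ℤ_pˣ`, of `ℤ_p`-rank one.
[cite: SerreLocalFields1979, Ch. XIV §7 Thm. 2] [cite: Washington1997, Thm. 14.2] -/
theorem toAdd_mul_toAdd_comm_of_mem_absInertia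
    (hu : (Rat.HeightOneSpectrum.primesEquiv u : ℕ) = p)
    (Λ₁ Λ₂ : absoluteGaloisGroup (u.adicCompletion ℚ) →* Multiplicative ℤ_[p])
    (h₁ : Continuous Λ₁) (h₂ : Continuous Λ₂)
    {σ τ : absoluteGaloisGroup (u.adicCompletion ℚ)}
    (hσ : σ ∈ absInertia (u.adicCompletion ℚ)) (hτ : τ ∈ absInertia (u.adicCompletion ℚ)) :
    (Λ₁ σ).toAdd * (Λ₂ τ).toAdd = (Λ₂ σ).toAdd * (Λ₁ τ).toAdd := by
  obtain ⟨g₁, hg₁⟩ :=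
    exists_continuousMonoidHom_apply_cyclotomicCharacter_eq_of_mem_absInertia p u hu Λ₁ h₁
  obtain ⟨g₂, hg₂⟩ :=
    exists_continuousMonoidHom_apply_cyclotomicCharacter_eq_of_mem_absInertia p u hu Λ₂ h₂
  obtain ⟨a, b, hab, h⟩ := PadicUnits.dependent g₁ g₂
  have hI : ∀ ρ ∈ absInertia (u.adicCompletion ℚ), a * (Λ₁ ρ).toAdd = b * (Λ₂ ρ).toAdd := by
    intro ρ hρ
    rw [← hg₁ ρ hρ, ← hg₂ ρ hρ]
    exact h _
  have eσ := hI σ hσ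
  have eτ := hI τ hτ
  rw [← sub_eq_zero]
  rcases hab with ha | hb
  · have key : a * ((Λ₁ σ).toAdd * (Λ₂ τ).toAdd - (Λ₂ σ).toAdd * (Λ₁ τ).toAdd) = 0 := by
      calc a * ((Λ₁ σ).toAdd * (Λ₂ τ).toAdd - (Λ₂ σ).toAdd * (Λ₁ τ).toAdd)
          = (a * (Λ₁ σ).toAdd) * (Λ₂ τ).toAdd - (Λ₂ σ).toAdd * (a * (Λ₁ τ).toAdd) := by ring
        _ = 0 := by rw [eσ, eτ]; ring
    exact (mul_eq_zero.mp key).resolve_left ha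
  · have key : b * ((Λ₁ σ).toAdd * (Λ₂ τ).toAdd - (Λ₂ σ).toAdd * (Λ₁ τ).toAdd) = 0 := by
      calc b * ((Λ₁ σ).toAdd * (Λ₂ τ).toAdd - (Λ₂ σ).toAdd * (Λ₁ τ).toAdd)
          = (Λ₁ σ).toAdd * (b * (Λ₂ τ).toAdd) - (b * (Λ₂ σ).toAdd) * (Λ₁ τ).toAdd := by ring
        _ = 0 := by rw [← eσ, ← eτ]; ring
    exact (mul_eq_zero.mp key).resolve_left hb

/-- **A torsion value of `χ_p` on inertia is killed by every continuous `ℤ_p`-valued character of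
`Γ_{ℚ_p}`**: if `σ ∈ I_{ℚ_u}` has `χ_p(σ)ⁿ = 1` for some `n ≥ 1` (e.g. `χ₂(σ) = -1`), then `Λ(σ) = 0`
— `Λ(σⁿ) = n·Λ(σ)` vanishes by `apply_eq_one_of_mem_absInertia_of_cyclotomicCharacter_eq_one` and
`ℤ_p` is torsion-free.  (Such `σ` fixes every `ℤ_p`-extension of `ℚ_p`.)
[cite: SerreLocalFields1979, Ch. XIV §7 Thm. 2] -/
theorem apply_eq_one_of_mem_absInertia_of_cyclotomicCharacter_pow_eq_one
    (hu : (Rat.HeightOneSpectrum.primesEquiv u : ℕ) = p)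
    (Λ : absoluteGaloisGroup (u.adicCompletion ℚ) →* Multiplicative ℤ_[p]) (hΛ : Continuous Λ)
    {σ : absoluteGaloisGroup (u.adicCompletion ℚ)} (hσ : σ ∈ absInertia (u.adicCompletion ℚ))
    {n : ℕ} (hn : 0 < n) (hχ : GaloisRep.cyclotomicCharacter (u.adicCompletion ℚ) p σ ^ n = 1) :
    Λ σ = 1 := by
  have hσn : σ ^ n ∈ absInertia (u.adicCompletion ℚ) := Subgroup.pow_mem _ hσ n
  have h := apply_eq_one_of_mem_absInertia_of_cyclotomicCharacter_eq_one p u hu Λ hΛ hσn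
    (by rw [map_pow, hχ])
  rw [map_pow] at h
  apply Multiplicative.toAdd.injective
  have h' : (n : ℤ_[p]) * (Λ σ).toAdd = 0 := by
    rw [← nsmul_eq_mul, ← toAdd_pow, h, toAdd_one]
  rw [toAdd_one]
  exact (mul_eq_zero.mp h').resolve_left (Nat.cast_ne_zero.mpr hn.ne')

end Local

/-! ### §2. Transport to the inertia groups of `Γ_K` above a completely split `p` -/

section Global

variable {K : Type*} [Field K] [NumberField K] (p : ℕ) [Fact p.Prime]

/-- **The transport `Γ_{ℚ_p} → Γ_K` at a completely split `p`** (the parent file's §2, isolated and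
completed).  `K/ℚ` Galois, `(p) = u` completely split in `K`, `w ∣ u`, `𝔓` a prime of `\bar ℤ_K` above
`w`.  There is a continuous homomorphism `φ : Γ_{ℚ_u} → Γ_K` such that `φ(I_{ℚ_u}) = I_𝔓` (every
element of `I_𝔓` is a `φ(x)`, `x ∈ I_{ℚ_u}`, and `φ` maps `I_{ℚ_u}` into `I_𝔓`) and
`χ_p(φ(x)) = χ_p(x)` for all `x`.  Construction: `𝔔 = 𝔓 ∩ \bar ℤ_ℚ`, `𝔓₀` the prime of `\bar ℤ_ℚ` cut
out by `ℚ̄ → \bar ℚ_u`, `ρ ∈ Γ_ℚ` with `ρ𝔓₀ = 𝔔` (Neukirch I (9.1)); `x ↦ ρ·res(x)·ρ⁻¹` lands in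
`D_𝔔 ⊆ res(Γ_K)` (complete splitting, Neukirch I (9.3); tree
`SorensenPatching.decompositionSubgroup_le_range_of_ncard_primesOver_eq`), `res : Γ_K → Γ_ℚ` is a
closed embedding, and `I_{𝔓₀} = res(I_{ℚ_u})` (Neukirch II (9.6), tree
`inertia_adicCompletionPrime_eq_map_absInertia`); `χ_p` is invariant under restriction (tree
`cyclotomicCharacter_absGaloisRestrict`) and conjugation.
[cite: NeukirchANT1999, Ch. I §9 (9.1), (9.3); Ch. II §9 Prop. (9.6)] [cite: SerreLocalFields1979, Ch. XIV §7 Thm. 2] -/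
theorem exists_continuous_hom_transport_inertia_of_ncard_primesOver_eq [IsGalois ℚ K]
    {u : HeightOneSpectrum (𝓞 ℚ)}
    (hsplit : (u.asIdeal.primesOver (𝓞 K)).ncard = Module.finrank ℚ K)
    {w : HeightOneSpectrum (𝓞 K)} (hwu : w.asIdeal.under (𝓞 ℚ) = u.asIdeal)
    {𝔓 : Ideal (absIntegers (𝓞 K) K)} (h𝔓 : 𝔓 ∈ w.primesAbove) :
    ∃ φ : absoluteGaloisGroup (u.adicCompletion ℚ) →* absoluteGaloisGroup K, Continuous φ ∧
      (∀ γ ∈ 𝔓.inertia (absoluteGaloisGroup K), ∃ x ∈ absInertia (u.adicCompletion ℚ), φ x = γ) ∧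
      (∀ x ∈ absInertia (u.adicCompletion ℚ), φ x ∈ 𝔓.inertia (absoluteGaloisGroup K)) ∧
      (∀ x, GaloisRep.cyclotomicCharacter K p (φ x) =
        GaloisRep.cyclotomicCharacter (u.adicCompletion ℚ) p x) := by
  have hp : p.Prime := Fact.out
  haveI : NeZero ((p : ℕ) : ℚ) := ⟨Nat.cast_ne_zero.mpr hp.ne_zero⟩
  -- the contracted prime `𝔔` of `\bar ℤ_ℚ`, the prime `𝔓₀` of the completion, and `ρ𝔓₀ = 𝔔`
  have h𝔔 : 𝔓.comap (absIntegersMap ℚ K) ∈ u.primesAbove :=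
    comap_absIntegersMap_mem_primesAbove hwu h𝔓
  have h𝔓₀ : adicCompletionPrime ℚ u ∈ u.primesAbove := adicCompletionPrime_mem_primesAbove ℚ u
  obtain ⟨ρ, hρ⟩ := HeightOneSpectrum.exists_smul_eq_of_mem_primesAbove_holds h𝔓₀ h𝔔
  -- `D_𝔔 ≤ res(Γ_K)` since `(p)` splits completely in `K`
  have hD : (𝔓.comap (absIntegersMap ℚ K)).decompositionSubgroup (absoluteGaloisGroup ℚ) ≤
      (absGaloisRestrict ℚ K).toMonoidHom.range :=
    SorensenPatching.decompositionSubgroup_le_range_of_ncard_primesOver_eq hsplit h𝔔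
  -- `ψ : x ↦ ρ res(x) ρ⁻¹` lands in `D_𝔔`
  set resu := (absGaloisRestrict ℚ (u.adicCompletion ℚ)).toMonoidHom with hresu_def
  set ψ : absoluteGaloisGroup (u.adicCompletion ℚ) →* absoluteGaloisGroup ℚ :=
    (MulAut.conj ρ).toMonoidHom.comp resu with hψ_def
  have hψ : ∀ x, ψ x = ρ * resu x * ρ⁻¹ := fun x => rfl
  have hψD : ∀ x, ψ x ∈
      (𝔓.comap (absIntegersMap ℚ K)).decompositionSubgroup (absoluteGaloisGroup ℚ) := by
    intro x
    have hx : resu x ∈ (adicCompletionPrime ℚ u).decompositionSubgroup (absoluteGaloisGroup ℚ) := by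
      rw [decompositionSubgroup_adicCompletionPrime_eq_range]
      exact ⟨x, rfl⟩
    rw [← hρ, hψ, Ideal.decompositionSubgroup_smul]
    exact Subgroup.smul_mem_pointwise_smul (resu x) (MulAut.conj ρ) _ hx
  have hψr : ∀ x, ψ x ∈ (absGaloisRestrict ℚ K).toMonoidHom.range := fun x => hD (hψD x)
  -- `φ : Γ_{ℚ_p} → Γ_K` with `res ∘ φ = ψ`
  set e : absoluteGaloisGroup K ≃* (absGaloisRestrict ℚ K).toMonoidHom.range :=
    MonoidHom.ofInjective (absGaloisRestrict_injective ℚ K) with he_def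
  set φ : absoluteGaloisGroup (u.adicCompletion ℚ) →* absoluteGaloisGroup K :=
    e.symm.toMonoidHom.comp (ψ.codRestrict _ hψr) with hφ_def
  have hφ : ∀ x, absGaloisRestrict ℚ K (φ x) = ψ x := by
    intro x
    have h1 : e (φ x) = ψ.codRestrict _ hψr x := by
      simp only [hφ_def, MonoidHom.coe_comp, MulEquiv.coe_toMonoidHom, Function.comp_apply,
        MulEquiv.apply_symm_apply]
    have h2 := congrArg Subtype.val h1
    rwa [he_def, MonoidHom.ofInjective_apply] at h2
  have hφc : Continuous φ := by
    rw [(isClosedEmbedding_absGaloisRestrict ℚ K).continuous_iff]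
    have hcomp : (absGaloisRestrict ℚ K : absoluteGaloisGroup K → absoluteGaloisGroup ℚ) ∘ φ =
        fun x => ρ * resu x * ρ⁻¹ := funext fun x => hφ x
    rw [hcomp]
    exact ((continuous_const.mul (absGaloisRestrict ℚ (u.adicCompletion ℚ)).continuous).mul
      continuous_const)
  refine ⟨φ, hφc, ?_, ?_, ?_⟩
  · -- every element of `I_𝔓` lifts to `I_{ℚ_p}` along `φ`
    intro γ hγ
    have h1 : absGaloisRestrict ℚ K γ ∈
        (ρ • adicCompletionPrime ℚ u).inertia (absoluteGaloisGroup ℚ) := by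
      rw [hρ]
      exact absGaloisRestrict_mem_inertia_comap ℚ K hγ
    have h2 : ρ⁻¹ * absGaloisRestrict ℚ K γ * ρ ∈
        (adicCompletionPrime ℚ u).inertia (absoluteGaloisGroup ℚ) :=
      (HeightOneSpectrum.mem_inertia_smul_absIntegers_iff ρ _ _).mp h1
    rw [inertia_adicCompletionPrime_eq_map_absInertia] at h2
    obtain ⟨x, hx, hxe⟩ := Subgroup.mem_map.mp h2
    refine ⟨x, hx, absGaloisRestrict_injective ℚ K ?_⟩
    rw [hφ, hψ]
    change ρ * absGaloisRestrict ℚ (u.adicCompletion ℚ) x * ρ⁻¹ = _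
    rw [show (absGaloisRestrict ℚ (u.adicCompletion ℚ)) x = ρ⁻¹ * absGaloisRestrict ℚ K γ * ρ
      from hxe]
    group
  · -- `φ` maps `I_{ℚ_p}` into `I_𝔓`
    intro x hx
    have h1 : resu x ∈ (adicCompletionPrime ℚ u).inertia (absoluteGaloisGroup ℚ) := by
      rw [inertia_adicCompletionPrime_eq_map_absInertia]
      exact Subgroup.mem_map_of_mem _ hx
    have h2 : ψ x ∈ (ρ • adicCompletionPrime ℚ u).inertia (absoluteGaloisGroup ℚ) := by
      rw [HeightOneSpectrum.mem_inertia_smul_absIntegers_iff ρ _ _, hψ]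
      have : ρ⁻¹ * (ρ * resu x * ρ⁻¹) * ρ = resu x := by group
      rw [this]
      exact h1
    rw [hρ] at h2
    rw [← comap_inertia_comap_absIntegersMap ℚ K 𝔓, Subgroup.mem_comap]
    change absGaloisRestrict ℚ K (φ x) ∈ _
    rw [hφ]
    exact h2
  · -- `χ_p ∘ φ = χ_p`
    intro x
    rw [← cyclotomicCharacter_absGaloisRestrict ℚ K p (φ x), hφ, hψ, map_mul, map_mul, map_inv,
      mul_comm (GaloisRep.cyclotomicCharacter ℚ p ρ) _, mul_inv_cancel_right]
    exact cyclotomicCharacter_absGaloisRestrict ℚ (u.adicCompletion ℚ) p x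

/-- **At a prime `p` that splits completely in the Galois number field `K`, two continuous
`ℤ_p`-valued characters of `Γ_K` are proportional on every inertia group above `p`** — for EVERY
prime `p` (the parent file's `toAdd_mul_comm_of_mem_inertia_of_ncard_primesOver_eq` had `p ≠ 2`):
transport §1 along `exists_continuous_hom_transport_inertia_of_ncard_primesOver_eq`.
[cite: SerreLocalFields1979, Ch. XIV §7 Thm. 2] [cite: NeukirchANT1999, Ch. I §9 (9.1), (9.3); Ch. II §9 Prop. (9.6)] -/
theorem toAdd_mul_toAdd_comm_of_mem_inertia_of_ncard_primesOver_eq [IsGalois ℚ K]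
    {u : HeightOneSpectrum (𝓞 ℚ)} (hu : (Rat.HeightOneSpectrum.primesEquiv u : ℕ) = p)
    (hsplit : (u.asIdeal.primesOver (𝓞 K)).ncard = Module.finrank ℚ K)
    {w : HeightOneSpectrum (𝓞 K)} (hwu : w.asIdeal.under (𝓞 ℚ) = u.asIdeal)
    {𝔓 : Ideal (absIntegers (𝓞 K) K)} (h𝔓 : 𝔓 ∈ w.primesAbove)
    (κ₁ κ₂ : absoluteGaloisGroup K →* Multiplicative ℤ_[p]) (h₁ : Continuous κ₁)
    (h₂ : Continuous κ₂) {σ τ : absoluteGaloisGroup K}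
    (hσ : σ ∈ 𝔓.inertia (absoluteGaloisGroup K)) (hτ : τ ∈ 𝔓.inertia (absoluteGaloisGroup K)) :
    (κ₁ σ).toAdd * (κ₂ τ).toAdd = (κ₂ σ).toAdd * (κ₁ τ).toAdd := by
  obtain ⟨φ, hφc, hlift, -, -⟩ :=
    exists_continuous_hom_transport_inertia_of_ncard_primesOver_eq p hsplit hwu h𝔓
  obtain ⟨x, hx, rfl⟩ := hlift σ hσ
  obtain ⟨y, hy, rfl⟩ := hlift τ hτ
  exact toAdd_mul_toAdd_comm_of_mem_absInertia p u hu (κ₁.comp φ) (κ₂.comp φ)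
    (h₁.comp hφc) (h₂.comp hφc) hx hy

/-- **At a completely split `p`, every torsion unit of `ℤ_pˣ` is the cyclotomic character of an
inertial element acting trivially on ALL `ℤ_p`-extensions of `K`.**  For `u₀ ∈ ℤ_pˣ` with
`u₀ⁿ = 1` (`n ≥ 1`) and a prime `𝔓` of `\bar ℤ_K` above `w ∣ p` there is `τ ∈ I_𝔓` with
`χ_p(τ) = u₀` and `κ(τ) = 0` for every continuous `κ : Γ_K → ℤ_p` (at `p = 2`, `u₀ = -1`: an element
of inertia acting by `-1` on `μ_{2^∞}` and fixing the whole `ℤ₂²`-tower).  Transport of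
`adicCompletion_rat_exists_mem_absInertia_cyclotomicCharacter_eq` (`χ_p(I_{ℚ_p}) = ℤ_pˣ`) and
`apply_eq_one_of_mem_absInertia_of_cyclotomicCharacter_pow_eq_one`.
[cite: SerreLocalFields1979, Ch. IV §4 Prop. 17] [cite: SerreLocalFields1979, Ch. XIV §7 Thm. 2] -/
theorem exists_mem_inertia_cyclotomicCharacter_eq_of_pow_eq_one_of_ncard_primesOver_eq
    [IsGalois ℚ K] {u : HeightOneSpectrum (𝓞 ℚ)} (hu : (Rat.HeightOneSpectrum.primesEquiv u : ℕ) = p)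
    (hsplit : (u.asIdeal.primesOver (𝓞 K)).ncard = Module.finrank ℚ K)
    {w : HeightOneSpectrum (𝓞 K)} (hwu : w.asIdeal.under (𝓞 ℚ) = u.asIdeal)
    {𝔓 : Ideal (absIntegers (𝓞 K) K)} (h𝔓 : 𝔓 ∈ w.primesAbove)
    {u₀ : ℤ_[p]ˣ} {n : ℕ} (hn : 0 < n) (hu₀ : u₀ ^ n = 1) :
    ∃ τ ∈ 𝔓.inertia (absoluteGaloisGroup K), GaloisRep.cyclotomicCharacter K p τ = u₀ ∧
      ∀ (κ : absoluteGaloisGroup K →* Multiplicative ℤ_[p]), Continuous κ → κ τ = 1 := by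
  obtain ⟨φ, hφc, -, hinto, hχ⟩ :=
    exists_continuous_hom_transport_inertia_of_ncard_primesOver_eq p hsplit hwu h𝔓
  obtain ⟨x, hx, hxu⟩ :=
    adicCompletion_rat_exists_mem_absInertia_cyclotomicCharacter_eq p u hu u₀
  refine ⟨φ x, hinto x hx, by rw [hχ, hxu], fun κ hκ => ?_⟩
  exact apply_eq_one_of_mem_absInertia_of_cyclotomicCharacter_pow_eq_one p u hu (κ.comp φ)
    (hκ.comp hφc) hx hn (by rw [hxu, hu₀])

end Global

/-! ### §3. Brink 2007, Cor. 1 in inertia form at EVERY prime: `K_∞⁻` is ramified above `p` -/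

section RatPlaces

/-- The finite places of `ℚ` containing a given rational prime coincide. [folklore] -/
private theorem rat_heightOneSpectrum_eq_of_natCast_mem' {u u' : HeightOneSpectrum (𝓞 ℚ)} {p : ℕ}
    (hp : p.Prime) (hu : (p : 𝓞 ℚ) ∈ u.asIdeal) (hu' : (p : 𝓞 ℚ) ∈ u'.asIdeal) : u = u' := by
  have key : ∀ u : HeightOneSpectrum (𝓞 ℚ), (p : 𝓞 ℚ) ∈ u.asIdeal →
      Rat.HeightOneSpectrum.natGenerator u = p := fun u h ↦ by
    have h1 : Rat.HeightOneSpectrum.natGenerator u ∣ p := by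
      rw [Rat.HeightOneSpectrum.natGenerator_dvd_iff]
      have h2 := Ideal.mem_map_of_mem (Rat.IsIntegralClosure.intEquiv (𝓞 ℚ)) h
      rwa [map_natCast] at h2
    exact (Nat.prime_dvd_prime_iff_eq (Rat.HeightOneSpectrum.prime_natGenerator u) hp).mp h1
  apply (Rat.HeightOneSpectrum.primesEquiv (R := 𝓞 ℚ)).injective
  exact Subtype.ext ((key u hu).trans (key u' hu').symm)

/-- `primesEquiv u = p` for a place `u` of `ℚ` containing the rational prime `p`. [folklore] -/
private theorem primesEquiv_eq_of_natCast_mem' {u : HeightOneSpectrum (𝓞 ℚ)} {p : ℕ}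
    (hp : p.Prime) (hu : (p : 𝓞 ℚ) ∈ u.asIdeal) :
    (Rat.HeightOneSpectrum.primesEquiv u : ℕ) = p := by
  have h1 : Rat.HeightOneSpectrum.natGenerator u ∣ p := by
    rw [Rat.HeightOneSpectrum.natGenerator_dvd_iff]
    have h2 := Ideal.mem_map_of_mem (Rat.IsIntegralClosure.intEquiv (𝓞 ℚ)) hu
    rwa [map_natCast] at h2
  exact (Nat.prime_dvd_prime_iff_eq (Rat.HeightOneSpectrum.prime_natGenerator u) hp).mp h1

/-- A place of a number field containing the rational prime `p` lies above the place `(p)` of `ℚ`.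
[folklore] -/
private theorem natCast_mem_under_rat' {K : Type*} [Field K] [NumberField K]
    {w : HeightOneSpectrum (𝓞 K)} {p : ℕ} (hpw : ((p : ℕ) : 𝓞 K) ∈ w.asIdeal) :
    (p : 𝓞 ℚ) ∈ (w.under (𝓞 ℚ)).asIdeal := by
  rw [HeightOneSpectrum.under_asIdeal, Ideal.under_def, Ideal.mem_comap, map_natCast]
  exact hpw

end RatPlaces

section ClassNumber

variable {K : Type} [Field K] [NumberField K] {p : ℕ} [Fact p.Prime]

/-- **Brink 2007, Cor. 1 in INERTIA form at EVERY prime `p`: the anticyclotomic `ℤ_p`-extension of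
an imaginary quadratic field is ramified at every prime of `\bar ℤ_K` above `p`** (the parent file's
`inertia_not_le_kerSubgroup_of_isAnticyclotomic` assumed `p ≠ 2`, only to know that the layers
`K_n/K`, of odd degree, are unramified at infinity; but `K` is totally complex, so EVERY finite
extension of `K` is unramified at the infinite places, Mathlib `InfinitePlace.isUnramified_iff`).
Printed (p. 2136): "The prime `l` is (infinitely) ramified in `K^anti`, since otherwise `K^anti`
would be an infinite unramified extension of `K`, contradicting the finiteness of the class
number."  Proof as the parent's: if `I_𝔓 ≤ ker κ` then every inertia group lies in `ker κ`
(pro-dihedral symmetry above `p`, Washington 13.2 away from `p`), so every layer `K_n/K` is abelian,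
everywhere unramified, of degree `pⁿ ∣ h_K` — absurd.
[cite: Brink2007, Cor. 1 (p. 2136) and its proof; §II Prop. 1 (p. 2130)] [cite: Washington1997, §13.1 Prop. 13.2] -/
theorem inertia_not_le_kerSubgroup_of_isAnticyclotomic_anyPrime (hK : IsImaginaryQuadratic K)
    (κ : ZpExtension K p) (hκ : κ.IsAnticyclotomic)
    {v : HeightOneSpectrum (𝓞 K)} (hpv : ((p : ℕ) : 𝓞 K) ∈ v.asIdeal)
    {𝔓 : Ideal (absIntegers (𝓞 K) K)} (h𝔓 : 𝔓 ∈ v.primesAbove) :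
    ¬ 𝔓.inertia (absoluteGaloisGroup K) ≤ κ.kerSubgroup := by
  intro hle
  have hp : p.Prime := Fact.out
  haveI : IsTotallyComplex K := hK.2
  have hI : ∀ (w : HeightOneSpectrum (𝓞 K)) (𝔓' : Ideal (absIntegers (𝓞 K) K)),
      𝔓' ∈ w.primesAbove → 𝔓'.inertia (absoluteGaloisGroup K) ≤ κ.kerSubgroup := by
    intro w 𝔓' h𝔓'
    by_cases hpw : ((p : ℕ) : 𝓞 K) ∈ w.asIdeal
    · exact inertia_le_kerSubgroup_of_natCast_mem_of_inertia_le hK.1 κ hκ hpv h𝔓 hle hpw h𝔓'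
    · exact inertia_le_kerSubgroup_holds K p κ hpw h𝔓'
  -- every layer has degree `pⁿ` dividing the class number
  have hdvd : ∀ n : ℕ, p ^ n ∣ Fintype.card (ClassGroup (𝓞 K)) := by
    intro n
    haveI : FiniteDimensional K (κ.layer n) := κ.finiteDimensional_layer_holds n
    haveI : IsGalois K (κ.layer n) := κ.isGalois_layer_holds n
    haveI : IsAbelianGalois K (κ.layer n) := κ.isAbelianGalois_layer n
    haveI : NumberField (κ.layer n) := NumberField.of_module_finite K (κ.layer n)
    haveI : IsUnramifiedAtInfinitePlaces K (κ.layer n) :=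
      ⟨fun w ↦ (InfinitePlace.isUnramified_iff).2
        (Or.inr (IsTotallyComplex.isComplex (w.comap (algebraMap K (κ.layer n)))))⟩
    have h := hilbertClassField.finrank_dvd_classNumber_of_abelian K (κ.layer n)
      (fun w ↦ isUnramifiedIn_layer_of_forall_inertia_le κ hI n w)
    rwa [κ.finrank_layer_holds n] at h
  -- but `p ^ h_K > h_K`
  have hpos : 0 < Fintype.card (ClassGroup (𝓞 K)) := Fintype.card_pos
  exact absurd (Nat.le_of_dvd hpos (hdvd _)) (not_le.mpr (Nat.lt_pow_self hp.one_lt))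

/-- Membership form, every prime `p`: **every inertia group above `p` contains an element acting
non-trivially on the anticyclotomic tower** (`κ τ ≠ 0` in `ℤ_p`).
[cite: Brink2007, Cor. 1 (p. 2136) and its proof] -/
theorem exists_mem_inertia_apply_ne_one_of_isAnticyclotomic_anyPrime (hK : IsImaginaryQuadratic K)
    (κ : ZpExtension K p) (hκ : κ.IsAnticyclotomic)
    {v : HeightOneSpectrum (𝓞 K)} (hpv : ((p : ℕ) : 𝓞 K) ∈ v.asIdeal)
    {𝔓 : Ideal (absIntegers (𝓞 K) K)} (h𝔓 : 𝔓 ∈ v.primesAbove) :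
    ∃ τ ∈ 𝔓.inertia (absoluteGaloisGroup K), κ τ ≠ 1 := by
  by_contra h
  exact inertia_not_le_kerSubgroup_of_isAnticyclotomic_anyPrime hK κ hκ hpv h𝔓
    fun τ hτ ↦ mem_kerSubgroup.mpr (by_contra fun hne ↦ h ⟨τ, hτ, hne⟩)

/-! ### §4. Assembly at every prime: `K̃_∞/K_∞⁻` is unramified above a split `p` -/

/-- **`K̃_∞/K_∞⁻` is unramified above `p`, EVERY prime `p`: for `K` imaginary quadratic, `p` SPLIT
in `K` (`v ≠ v̄` above `p`), an anticyclotomic `ℤ_p`-extension `κ₁` and ANY `ℤ_p`-extension `κ₂` of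
`K`, the inertia group of every prime `𝔓` of `\bar ℤ_K` above `p` satisfies `I_𝔓 ⊓ ker κ₁ ≤ ker κ₂`**
(the parent file's `inertia_inf_kerSubgroup_le_kerSubgroup_of_isAnticyclotomic` without `p ≠ 2`):
by §3 there is `τ ∈ I_𝔓` with `κ₁ τ ≠ 0`; by §2 (local Kronecker–Weber at the split prime)
`κ₂(σ)·κ₁(τ) = κ₁(σ)·κ₂(τ) = 0` for `σ ∈ I_𝔓 ∩ ker κ₁`; `ℤ_p` is a domain.  (Greenberg, LNM 1716 §1
p. 53: "`F̃/F_∞` is unramified if `p` … splits completely"; de Shalit II.4.17.)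
[cite: GreenbergLNM1716, §1 p. 53] [cite: Greenberg1978, §4 p. 94] [cite: deShalit1987, II.1.9, II.4.17]
[cite: SerreLocalFields1979, Ch. XIV §7 Thm. 2] [cite: Brink2007, Cor. 1 (p. 2136)] -/
theorem inertia_inf_kerSubgroup_le_kerSubgroup_of_isAnticyclotomic_anyPrime
    (hK : IsImaginaryQuadratic K) {κ₁ : ZpExtension K p} (hκ₁ : κ₁.IsAnticyclotomic)
    (κ₂ : ZpExtension K p) {v vbar : HeightOneSpectrum (𝓞 K)} (hpv : ((p : ℕ) : 𝓞 K) ∈ v.asIdeal)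
    (hpvbar : ((p : ℕ) : 𝓞 K) ∈ vbar.asIdeal) (hne : vbar ≠ v)
    {w : HeightOneSpectrum (𝓞 K)} (hpw : ((p : ℕ) : 𝓞 K) ∈ w.asIdeal)
    {𝔓 : Ideal (absIntegers (𝓞 K) K)} (h𝔓 : 𝔓 ∈ w.primesAbove) :
    𝔓.inertia (absoluteGaloisGroup K) ⊓ κ₁.kerSubgroup ≤ κ₂.kerSubgroup := by
  have hp : p.Prime := Fact.out
  intro σ hσ
  obtain ⟨hσI, hσ₁⟩ := Subgroup.mem_inf.mp hσ
  haveI : Algebra.IsQuadraticExtension ℚ K := ⟨hK.1⟩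
  haveI : IsGalois ℚ K := inferInstance
  -- the place `u = (p)` of `ℚ` below `w`, and the complete splitting of `(p)` in `K`
  have hu : (Rat.HeightOneSpectrum.primesEquiv (w.under (𝓞 ℚ)) : ℕ) = p :=
    primesEquiv_eq_of_natCast_mem' hp (natCast_mem_under_rat' hpw)
  have hwu : w.asIdeal.under (𝓞 ℚ) = (w.under (𝓞 ℚ)).asIdeal :=
    (HeightOneSpectrum.under_asIdeal (𝓞 ℚ) w).symm
  have hsplit : (((w.under (𝓞 ℚ)).asIdeal).primesOver (𝓞 K)).ncard = Module.finrank ℚ K := by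
    rw [rat_heightOneSpectrum_eq_of_natCast_mem' hp (natCast_mem_under_rat' hpw)
      (natCast_mem_under_rat' hpv)]
    exact ncard_primesOver_under_eq_finrank_of_ne hK.1 hpv hpvbar hne
  -- a ramified element for `κ₁`
  obtain ⟨τ, hτI, hτ⟩ :=
    exists_mem_inertia_apply_ne_one_of_isAnticyclotomic_anyPrime hK κ₁ hκ₁ hpw h𝔓
  -- proportionality on `I_𝔓`
  have hdet := toAdd_mul_toAdd_comm_of_mem_inertia_of_ncard_primesOver_eq p hu hsplit hwu h𝔓
    κ₁.toContinuousMonoidHom.toMonoidHom κ₂.toContinuousMonoidHom.toMonoidHom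
    κ₁.toContinuousMonoidHom.continuous κ₂.toContinuousMonoidHom.continuous hσI hτI
  change (κ₁ σ).toAdd * (κ₂ τ).toAdd = (κ₂ σ).toAdd * (κ₁ τ).toAdd at hdet
  rw [mem_kerSubgroup] at hσ₁ ⊢
  rw [hσ₁, toAdd_one, zero_mul, eq_comm, mul_eq_zero] at hdet
  rcases hdet with h | h
  · exact Multiplicative.toAdd.injective (by rw [h, toAdd_one])
  · exact absurd (Multiplicative.toAdd.injective (by rw [h, toAdd_one])) hτ

/-- Membership form at every prime: **an element of an inertia group above the split prime `p` which
fixes the anticyclotomic tower fixes every `ℤ_p`-extension of the imaginary quadratic field `K`.**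
[cite: GreenbergLNM1716, §1 p. 53] [cite: Greenberg1978, §4 p. 94] [cite: Brink2007, Cor. 1 (p. 2136)] -/
theorem apply_eq_one_of_mem_inertia_of_isAnticyclotomic_anyPrime (hK : IsImaginaryQuadratic K)
    {κ₁ : ZpExtension K p} (hκ₁ : κ₁.IsAnticyclotomic) (κ₂ : ZpExtension K p)
    {v vbar : HeightOneSpectrum (𝓞 K)} (hpv : ((p : ℕ) : 𝓞 K) ∈ v.asIdeal)
    (hpvbar : ((p : ℕ) : 𝓞 K) ∈ vbar.asIdeal) (hne : vbar ≠ v)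
    {w : HeightOneSpectrum (𝓞 K)} (hpw : ((p : ℕ) : 𝓞 K) ∈ w.asIdeal)
    {𝔓 : Ideal (absIntegers (𝓞 K) K)} (h𝔓 : 𝔓 ∈ w.primesAbove)
    {σ : absoluteGaloisGroup K} (hσ : σ ∈ 𝔓.inertia (absoluteGaloisGroup K)) (hσ₁ : κ₁ σ = 1) :
    κ₂ σ = 1 :=
  mem_kerSubgroup.mp (inertia_inf_kerSubgroup_le_kerSubgroup_of_isAnticyclotomic_anyPrime hK hκ₁
    κ₂ hpv hpvbar hne hpw h𝔓 ⟨hσ, mem_kerSubgroup.mpr hσ₁⟩)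

/-- **At a split prime `p` of an imaginary quadratic field (indeed of any quadratic field with
`v ≠ v̄` above `p`), every torsion unit `u₀ ∈ ℤ_pˣ` (`u₀ⁿ = 1`, `n ≥ 1`) is `χ_p(τ)` for some `τ` in
the inertia group `I_𝔓` of any prime `𝔓` of `\bar ℤ_K` above `p` which acts trivially on EVERY
`ℤ_p`-extension of `K`** (`κ τ = 1` for all `κ : ZpExtension K p`).  At `p = 2`, `u₀ = -1`: an
inertial element acting by `-1` on `μ_{2^∞}` and fixing the `ℤ₂²`-tower `K̃_∞`.
[cite: SerreLocalFields1979, Ch. IV §4 Prop. 17] [cite: SerreLocalFields1979, Ch. XIV §7 Thm. 2] -/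
theorem exists_mem_inertia_cyclotomicCharacter_eq_of_pow_eq_one_of_ne
    (hK2 : Module.finrank ℚ K = 2) {v vbar : HeightOneSpectrum (𝓞 K)}
    (hpv : ((p : ℕ) : 𝓞 K) ∈ v.asIdeal) (hpvbar : ((p : ℕ) : 𝓞 K) ∈ vbar.asIdeal) (hne : vbar ≠ v)
    {w : HeightOneSpectrum (𝓞 K)} (hpw : ((p : ℕ) : 𝓞 K) ∈ w.asIdeal)
    {𝔓 : Ideal (absIntegers (𝓞 K) K)} (h𝔓 : 𝔓 ∈ w.primesAbove)
    {u₀ : ℤ_[p]ˣ} {n : ℕ} (hn : 0 < n) (hu₀ : u₀ ^ n = 1) :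
    ∃ τ ∈ 𝔓.inertia (absoluteGaloisGroup K), GaloisRep.cyclotomicCharacter K p τ = u₀ ∧
      ∀ κ : ZpExtension K p, κ τ = 1 := by
  have hp : p.Prime := Fact.out
  haveI : Algebra.IsQuadraticExtension ℚ K := ⟨hK2⟩
  haveI : IsGalois ℚ K := inferInstance
  have hu : (Rat.HeightOneSpectrum.primesEquiv (w.under (𝓞 ℚ)) : ℕ) = p :=
    primesEquiv_eq_of_natCast_mem' hp (natCast_mem_under_rat' hpw)
  have hwu : w.asIdeal.under (𝓞 ℚ) = (w.under (𝓞 ℚ)).asIdeal :=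
    (HeightOneSpectrum.under_asIdeal (𝓞 ℚ) w).symm
  have hsplit : (((w.under (𝓞 ℚ)).asIdeal).primesOver (𝓞 K)).ncard = Module.finrank ℚ K := by
    rw [rat_heightOneSpectrum_eq_of_natCast_mem' hp (natCast_mem_under_rat' hpw)
      (natCast_mem_under_rat' hpv)]
    exact ncard_primesOver_under_eq_finrank_of_ne hK2 hpv hpvbar hne
  obtain ⟨τ, hτI, hχ, hall⟩ :=
    exists_mem_inertia_cyclotomicCharacter_eq_of_pow_eq_one_of_ncard_primesOver_eq p hu hsplit hwu
      h𝔓 hn hu₀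
  exact ⟨τ, hτI, hχ, fun κ ↦ hall κ.toContinuousMonoidHom.toMonoidHom
    κ.toContinuousMonoidHom.continuous⟩

end ClassNumber

/-! ### §5. The same statements in the currency of the tree's Greenberg Selmer groups
(`GreenbergSelmer.inertia w`, `GreenbergSelmer.decomp w`) -/

section Greenberg

open Literature.NumberTheory.EllipticCurves.GreenbergSelmer

variable {K : Type} [Field K] [NumberField K] {p : ℕ} [Fact p.Prime]

/-- The tree's inertia group `GreenbergSelmer.inertia w = res(I_{K_w}) ≤ Γ_K` at the place `w` (for the
chosen embedding `K̄ → K̄_w`) IS the inertia group `I_{𝔓₀}` of the prime `𝔓₀ = adicCompletionPrime K w`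
of `\bar ℤ_K` cut out by that embedding (tree `inertia_adicCompletionPrime_eq_map_absInertia`,
Neukirch II (9.6)). [cite: NeukirchANT1999, Ch. II §9 Prop. (9.6)] -/
theorem greenbergSelmer_inertia_eq_inertia_adicCompletionPrime (w : HeightOneSpectrum (𝓞 K)) :
    inertia w = (adicCompletionPrime K w).inertia (absoluteGaloisGroup K) := by
  rw [inertia_adicCompletionPrime_eq_map_absInertia]
  rfl

/-- **`K_∞⁻/K` is ramified at `w ∣ p` in the Greenberg–Selmer currency**: some element of
`GreenbergSelmer.inertia w` acts non-trivially on the anticyclotomic tower (every prime `p`).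
[cite: Brink2007, Cor. 1 (p. 2136) and its proof] -/
theorem exists_mem_greenbergSelmer_inertia_apply_ne_one_of_isAnticyclotomic
    (hK : IsImaginaryQuadratic K) (κ : ZpExtension K p) (hκ : κ.IsAnticyclotomic)
    {w : HeightOneSpectrum (𝓞 K)} (hpw : ((p : ℕ) : 𝓞 K) ∈ w.asIdeal) :
    ∃ τ ∈ inertia w, κ τ ≠ 1 := by
  rw [greenbergSelmer_inertia_eq_inertia_adicCompletionPrime]
  exact exists_mem_inertia_apply_ne_one_of_isAnticyclotomic_anyPrime hK κ hκ hpw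
    (adicCompletionPrime_mem_primesAbove K w)

/-- **`K̃_∞/K_∞⁻` is unramified above a split `p` in the Greenberg–Selmer currency**: for `K`
imaginary quadratic, `p` split (`v ≠ v̄` above `p`), `κ₁` anticyclotomic and `κ₂` any
`ℤ_p`-extension, `GreenbergSelmer.inertia w ⊓ ker κ₁ ≤ ker κ₂` at every `w ∣ p` (every prime `p`).
[cite: GreenbergLNM1716, §1 p. 53] [cite: Greenberg1978, §4 p. 94] [cite: deShalit1987, II.4.17] -/
theorem greenbergSelmer_inertia_inf_kerSubgroup_le_kerSubgroup_of_isAnticyclotomic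
    (hK : IsImaginaryQuadratic K) {κ₁ : ZpExtension K p} (hκ₁ : κ₁.IsAnticyclotomic)
    (κ₂ : ZpExtension K p) {v vbar : HeightOneSpectrum (𝓞 K)} (hpv : ((p : ℕ) : 𝓞 K) ∈ v.asIdeal)
    (hpvbar : ((p : ℕ) : 𝓞 K) ∈ vbar.asIdeal) (hne : vbar ≠ v)
    {w : HeightOneSpectrum (𝓞 K)} (hpw : ((p : ℕ) : 𝓞 K) ∈ w.asIdeal) :
    inertia w ⊓ κ₁.kerSubgroup ≤ κ₂.kerSubgroup := by
  rw [greenbergSelmer_inertia_eq_inertia_adicCompletionPrime]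
  exact inertia_inf_kerSubgroup_le_kerSubgroup_of_isAnticyclotomic_anyPrime hK hκ₁ κ₂ hpv hpvbar
    hne hpw (adicCompletionPrime_mem_primesAbove K w)

/-- **A torsion unit of `ℤ_pˣ` as the cyclotomic character of an element of
`GreenbergSelmer.inertia w` fixing every `ℤ_p`-extension**, at a split prime `p` of a quadratic field
(`v ≠ v̄` above `p`, `w ∣ p`): `∃ τ ∈ inertia w, χ_p(τ) = u₀ ∧ ∀ κ, κ τ = 1` (`u₀ⁿ = 1`, `n ≥ 1`).
[cite: SerreLocalFields1979, Ch. IV §4 Prop. 17] [cite: SerreLocalFields1979, Ch. XIV §7 Thm. 2] -/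
theorem exists_mem_greenbergSelmer_inertia_cyclotomicCharacter_eq_of_pow_eq_one
    (hK2 : Module.finrank ℚ K = 2) {v vbar : HeightOneSpectrum (𝓞 K)}
    (hpv : ((p : ℕ) : 𝓞 K) ∈ v.asIdeal) (hpvbar : ((p : ℕ) : 𝓞 K) ∈ vbar.asIdeal) (hne : vbar ≠ v)
    {w : HeightOneSpectrum (𝓞 K)} (hpw : ((p : ℕ) : 𝓞 K) ∈ w.asIdeal)
    {u₀ : ℤ_[p]ˣ} {n : ℕ} (hn : 0 < n) (hu₀ : u₀ ^ n = 1) :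
    ∃ τ ∈ inertia w, GaloisRep.cyclotomicCharacter K p τ = u₀ ∧ ∀ κ : ZpExtension K p, κ τ = 1 := by
  rw [greenbergSelmer_inertia_eq_inertia_adicCompletionPrime]
  exact exists_mem_inertia_cyclotomicCharacter_eq_of_pow_eq_one_of_ne hK2 hpv hpvbar hne hpw
    (adicCompletionPrime_mem_primesAbove K w) hn hu₀

end Greenberg

end Literature.NumberTheory.EllipticCurves.ZpExtension

end
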